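import Summits.SmoothPoincare4.SmoothPoincare4.Theorems.CylinderEntropyCylinderRungTwoGraphicalIsSphere
import Summits.SmoothPoincare4.SmoothPoincare4.Theorems.CylinderEntropyCylinderRungTwoFluxIdentityGram
import Literature.Geometry.Manifold.CylinderSlice
import Literature.Geometry.Riemannian.SphericalCylinderEntropy
import Literature.Topology.FourManifolds.WhitneyModelSheets
import Mathlib.Geometry.Manifold.LocalDiffeomorph
import Mathlib.Geometry.Manifold.Instances.Sphere
import HarnessLib

/-!
# A cross-section of `S⁴ × ℝ` of constant height is a whole slice

Stub `helper_sliceOfConstantHeight` (rigidity layer R1-C) of line `killing-flux` for the crux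
`CylinderEntropy.CylinderRungTwo` (stmt-SmoothPoincare4-7631).

## What

Let `N = {z ∈ ℝ⁶ | ∑_{i<5} zᵢ² = 1} = S⁴ × ℝ`, whose slices `S⁴ × {c}` are the images of the slice
embeddings `sliceMap c : S⁴ → ℝ⁶` (`Literature.Geometry.Manifold.CylinderSlice`). Let `ι : M → ℝ⁶`
be a smooth embedding of a compact connected boundaryless `4`-manifold `M` with image in `N` and of
*constant height* `(ι x)₅ = c`. Then the image of `ι` is the whole slice,
`range ι = range (sliceMap c)`, and `M` is diffeomorphic to the unit sphere `S⁴ ⊂ ℝ⁵`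
(`helper_sliceOfConstantHeight`, registered signature).

## Proof (fact-free)

A point `z ∈ ℝ⁶` is determined by its shadow `truncL z ∈ ℝ⁵` (drop the last coordinate) and its
height `z₅` (`eq_of_truncL_eq_of_apply_five_eq`). Hence the shadow `truncL ∘ ι` is injective (all
heights equal `c` and `ι` is injective), and it is immersive: by the chain rule
`d(truncL ∘ ι) = truncL ∘ dι` and `0 = d(height) = pr₅ ∘ dι` (the height `x ↦ (ι x)₅` is constant),
so `truncL (dι v) = truncL (dι w)` forces `dι v = dι w` and `v = w` (`dι` is injective for an
embedding, tree `mfderiv_injective_of_isSmoothEmbedding`). The landed stub `stub_graphicalIsSphere`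
(file `…GraphicalIsSphere.lean`: inverse function theorem + clopen range) then gives `M ≃ₘ S⁴`.
For the range, `⊆` is immediate from `range_sliceMap`; for `⊇`, the co-restriction `g : M → S⁴`
of the shadow is a local diffeomorphism (inverse function theorem in equal dimensions, tree
`Literature.Topology.FourManifolds.isLocalDiffeomorphAt_of_mfderiv_injective`) from a nonempty
compact space to the connected Hausdorff `S⁴`, hence surjective
(`surjective_of_isLocalDiffeomorph`); the point `x` whose shadow is that of a slice point `z` has
`ι x = z`, both having height `c`.

## References

* [HirschDT1976] M. W. Hirsch, *Differential Topology*, GTM 33, Springer 1976, Ch. 1 §3 Thm. 3.1.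
* [LeeSmoothManifolds2013] J. M. Lee, *Introduction to Smooth Manifolds*, 2nd ed., GTM 218,
  Springer 2013, Thm. 4.5 and Prop. 4.8.
-/

-- the prescribed namespace `Summit.SmoothPoincare4.SmoothPoincare4.…` repeats `SmoothPoincare4`
set_option linter.dupNamespace false

noncomputable section

open scoped Manifold ContDiff
open Function Set
open Literature.Geometry.Riemannian.SphericalCylinderEntropy (truncL truncL_apply)
open Literature.Geometry.Manifold.CylinderSlice (sliceMap range_sliceMap
  preconnectedSpace_sphere_four)
open Summit.SmoothPoincare4.SmoothPoincare4.Theorems.CylinderRungTwo.KillingFlux (truncL_mem_sphere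
  surjective_of_isLocalDiffeomorph stub_graphicalIsSphere mfderiv_injective_of_isSmoothEmbedding)

namespace Summit.SmoothPoincare4.SmoothPoincare4.Cruxes.CylinderRungTwo.KillingFlux

/-- A point of `ℝ⁶` is determined by its shadow in `ℝ⁵` (drop the last coordinate) and its height
(last coordinate). [folklore] -/
theorem eq_of_truncL_eq_of_apply_five_eq {z w : EuclideanSpace ℝ (Fin 6)} (h : truncL z = truncL w)
    (h5 : z 5 = w 5) : z = w := by
  ext j
  induction j using Fin.lastCases with
  | last => rw [show (Fin.last 5 : Fin 6) = 5 from rfl]; exact h5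
  | cast i => simpa only [truncL_apply] using congrArg (fun y : EuclideanSpace ℝ (Fin 5) => y i) h

/-- The shadow `truncL ∘ ι` of an injective map `ι` into `ℝ⁶` of constant height is injective.
[folklore] -/
theorem injective_truncL_comp_of_height_const {M : Type} {ι : M → EuclideanSpace ℝ (Fin 6)}
    (hinj : Injective ι) {c : ℝ} (hc : ∀ x, ι x 5 = c) :
    Injective ((truncL : EuclideanSpace ℝ (Fin 6) → EuclideanSpace ℝ (Fin 5)) ∘ ι) :=
  fun x y h => hinj (eq_of_truncL_eq_of_apply_five_eq h ((hc x).trans (hc y).symm))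

/-- The shadow `truncL ∘ ι` of a smooth embedding `ι : M⁴ → ℝ⁶` of constant height is an
immersion: `d(truncL ∘ ι)_x = truncL ∘ dι_x` and `pr₅ ∘ dι_x = d(x ↦ (ι x)₅) = 0` (chain rule,
constant height), so `truncL (dι v) = truncL (dι w)` gives `dι v = dι w`, whence `v = w` as `dι_x`
is injective. [folklore] -/
theorem injective_mfderiv_truncL_comp_of_height_const {M : Type} [TopologicalSpace M]
    [ChartedSpace (EuclideanSpace ℝ (Fin 4)) M] [IsManifold (𝓡 4) ∞ M]
    {ι : M → EuclideanSpace ℝ (Fin 6)} (hι : Manifold.IsSmoothEmbedding (𝓡 4) (𝓡 6) ∞ ι) {c : ℝ}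
    (hc : ∀ x, ι x 5 = c) (x : M) :
    Injective (mfderiv (𝓡 4) (𝓡 5)
      ((truncL : EuclideanSpace ℝ (Fin 6) → EuclideanSpace ℝ (Fin 5)) ∘ ι) x) := by
  have hιd : MDifferentiableAt (𝓡 4) (𝓡 6) ι x :=
    hι.contMDiff.contMDiffAt.mdifferentiableAt (by simp)
  -- chain rule for the shadow
  have hsh : mfderiv (𝓡 4) (𝓡 5)
        ((truncL : EuclideanSpace ℝ (Fin 6) → EuclideanSpace ℝ (Fin 5)) ∘ ι) x =
      (truncL : EuclideanSpace ℝ (Fin 6) →L[ℝ] EuclideanSpace ℝ (Fin 5)).comp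
        (mfderiv (𝓡 4) (𝓡 6) ι x) :=
    ((truncL.hasMFDerivAt (x := ι x)).comp x hιd.hasMFDerivAt).mfderiv
  -- chain rule for the height, which is the constant function `c`
  have hht : (EuclideanSpace.proj (5 : Fin 6) : EuclideanSpace ℝ (Fin 6) →L[ℝ] ℝ).comp
        (mfderiv (𝓡 4) (𝓡 6) ι x) = (0 : TangentSpace (𝓡 4) x →L[ℝ] ℝ) := by
    have hcomp :=
      ((EuclideanSpace.proj (5 : Fin 6) : EuclideanSpace ℝ (Fin 6) →L[ℝ] ℝ).hasMFDerivAt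
        (x := ι x)).comp x hιd.hasMFDerivAt
    have hconst : HasMFDerivAt (𝓡 4) 𝓘(ℝ, ℝ)
        (((EuclideanSpace.proj (5 : Fin 6) : EuclideanSpace ℝ (Fin 6) →L[ℝ] ℝ) :
          EuclideanSpace ℝ (Fin 6) → ℝ) ∘ ι) x (0 : TangentSpace (𝓡 4) x →L[ℝ] ℝ) := by
      have heq : (((EuclideanSpace.proj (5 : Fin 6) : EuclideanSpace ℝ (Fin 6) →L[ℝ] ℝ) :
          EuclideanSpace ℝ (Fin 6) → ℝ) ∘ ι) = fun _ => c :=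
        funext fun y => by simpa using hc y
      rw [heq]
      exact hasMFDerivAt_const (I := 𝓡 4) (I' := 𝓘(ℝ, ℝ)) c x
    exact hcomp.mfderiv.symm.trans hconst.mfderiv
  rw [hsh]
  intro v w hvw
  -- `hvw : truncL (dι v) = truncL (dι w)` (definitionally)
  refine mfderiv_injective_of_isSmoothEmbedding hι x (eq_of_truncL_eq_of_apply_five_eq hvw ?_)
  have hv := congrArg (fun L : TangentSpace (𝓡 4) x →L[ℝ] ℝ => L v) hht
  have hw := congrArg (fun L : TangentSpace (𝓡 4) x →L[ℝ] ℝ => L w) hht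
  simp only [ContinuousLinearMap.comp_apply, zero_apply, PiLp.proj_apply] at hv hw
  exact hv.trans hw.symm

/-- **The shadow of a compact graphical cross-section covers `S⁴`.** If `ι : M → N` is smooth on a
nonempty compact boundaryless `4`-manifold with image in the cylinder `N = {∑_{i<5} zᵢ² = 1}` and
the shadow `truncL ∘ ι` has injective differential everywhere, then every point of the unit sphere
`S⁴ ⊂ ℝ⁵` is a shadow: the co-restriction `M → S⁴` of the shadow is a local diffeomorphism (inverse
function theorem, equal dimensions), so its range is open, compact and nonempty in the connected
`S⁴`. [cite: HirschDT1976, Ch. 1 §3 Thm. 3.1] -/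
theorem exists_truncL_comp_eq_of_injective_mfderiv {M : Type} [TopologicalSpace M]
    [ChartedSpace (EuclideanSpace ℝ (Fin 4)) M] [IsManifold (𝓡 4) ∞ M] [CompactSpace M]
    [Nonempty M] {ι : M → EuclideanSpace ℝ (Fin 6)} (hsm : ContMDiff (𝓡 4) (𝓡 6) ∞ ι)
    (hN : ∀ x, ∑ i : Fin 5, ι x (Fin.castSucc i) ^ 2 = 1)
    (himm : ∀ x : M, Injective (mfderiv (𝓡 4) (𝓡 5)
      ((truncL : EuclideanSpace ℝ (Fin 6) → EuclideanSpace ℝ (Fin 5)) ∘ ι) x))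
    (q : Metric.sphere (0 : EuclideanSpace ℝ (Fin 5)) 1) :
    ∃ x : M, truncL (ι x) = (q : EuclideanSpace ℝ (Fin 5)) := by
  haveI : Fact (Module.finrank ℝ (EuclideanSpace ℝ (Fin 5)) = 4 + 1) := ⟨finrank_euclideanSpace_fin⟩
  -- the shadow lands in the unit sphere `S⁴ ⊂ ℝ⁵`
  have hmem : ∀ x, ((truncL : EuclideanSpace ℝ (Fin 6) → EuclideanSpace ℝ (Fin 5)) ∘ ι) x ∈
      Metric.sphere (0 : EuclideanSpace ℝ (Fin 5)) 1 := fun x => truncL_mem_sphere (hN x)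
  -- its co-restriction `g : M → S⁴`
  set g : M → Metric.sphere (0 : EuclideanSpace ℝ (Fin 5)) 1 := Set.codRestrict _ _ hmem with hg
  have hval_g : (Subtype.val ∘ g) =
      ((truncL : EuclideanSpace ℝ (Fin 6) → EuclideanSpace ℝ (Fin 5)) ∘ ι) := rfl
  -- smoothness of the shadow and of `g`
  have hsm' : ContMDiff (𝓡 4) (𝓡 5) ∞
      ((truncL : EuclideanSpace ℝ (Fin 6) → EuclideanSpace ℝ (Fin 5)) ∘ ι) :=
    truncL.contDiff.comp_contMDiff hsm
  have hgs : ContMDiff (𝓡 4) (𝓡 4) ∞ g := hsm'.codRestrict_sphere hmem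
  -- the differential of `g` is injective (chain rule through `Subtype.val ∘ g = truncL ∘ ι`)
  have hval : ContMDiff (𝓡 4) (𝓡 5) ∞
      (Subtype.val : Metric.sphere (0 : EuclideanSpace ℝ (Fin 5)) 1 → EuclideanSpace ℝ (Fin 5)) :=
    contMDiff_coe_sphere
  have hdg : ∀ x, Injective (mfderiv (𝓡 4) (𝓡 4) g x) := by
    intro x
    have hgd : MDifferentiableAt (𝓡 4) (𝓡 4) g x := (hgs x).mdifferentiableAt (by simp)
    have hvd : MDifferentiableAt (𝓡 4) (𝓡 5)
        (Subtype.val : Metric.sphere (0 : EuclideanSpace ℝ (Fin 5)) 1 → EuclideanSpace ℝ (Fin 5))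
        (g x) := (hval (g x)).mdifferentiableAt (by simp)
    have h := himm x
    rw [← hval_g, mfderiv_comp x hvd hgd] at h
    exact Injective.of_comp h
  -- `g` is a local diffeomorphism (inverse function theorem, equal dimensions), hence surjective
  have hloc : IsLocalDiffeomorph (𝓡 4) (𝓡 4) ∞ g := fun x =>
    Literature.Topology.FourManifolds.isLocalDiffeomorphAt_of_mfderiv_injective isOpen_univ
      (mem_univ x) hgs.contMDiffOn (by simp) rfl (hdg x)
  haveI := preconnectedSpace_sphere_four
  obtain ⟨x, hx⟩ := surjective_of_isLocalDiffeomorph hloc q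
  exact ⟨x, congrArg Subtype.val hx⟩

/-- **A cross-section of constant height is a whole slice** (stub `helper_sliceOfConstantHeight`,
rigidity layer R1-C of line `killing-flux`, crux `CylinderEntropy.CylinderRungTwo`). If `M` is a
compact connected boundaryless `4`-manifold and `ι : M → ℝ⁶` a smooth embedding into the cylinder
`N = {∑_{i<5} zᵢ² = 1}` of constant height `(ι x)₅ = c`, then `range ι` is the slice
`S⁴ × {c} = range (sliceMap c)` and `M ≃ₘ S⁴`: the shadow `truncL ∘ ι` is an injective immersion
(a point of `ℝ⁶` is its shadow plus its height), so `stub_graphicalIsSphere` applies, and the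
shadow covers `S⁴` (local diffeomorphism from a compact space onto a connected one).
[cite: HirschDT1976, Ch. 1 §3 Thm. 3.1] -/
theorem helper_sliceOfConstantHeight :
    ∀ (M : Type) [TopologicalSpace M] [T2Space M] [SecondCountableTopology M]
      [ChartedSpace (EuclideanSpace ℝ (Fin 4)) M] [IsManifold (𝓡 4) ∞ M] [CompactSpace M]
      [ConnectedSpace M] (ι : M → EuclideanSpace ℝ (Fin 6)),
      Manifold.IsSmoothEmbedding (𝓡 4) (𝓡 6) ∞ ι →
      (∀ x, ∑ i : Fin 5, ι x (Fin.castSucc i) ^ 2 = 1) →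
      ∀ c : ℝ, (∀ x, ι x 5 = c) →
        Set.range ι = Set.range (Literature.Geometry.Manifold.CylinderSlice.sliceMap c) ∧
          Nonempty (M ≃ₘ⟮𝓡 4, 𝓡 4⟯ Metric.sphere (0 : EuclideanSpace ℝ (Fin 5)) 1) := by
  intro M _ _ _ _ _ _ _ ι hι hN c hc
  have hinj : Injective ((truncL : EuclideanSpace ℝ (Fin 6) → EuclideanSpace ℝ (Fin 5)) ∘ ι) :=
    injective_truncL_comp_of_height_const hι.isEmbedding.injective hc
  have himm : ∀ x : M, Injective (mfderiv (𝓡 4) (𝓡 5)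
      ((truncL : EuclideanSpace ℝ (Fin 6) → EuclideanSpace ℝ (Fin 5)) ∘ ι) x) :=
    injective_mfderiv_truncL_comp_of_height_const hι hc
  refine ⟨?_, stub_graphicalIsSphere M ι hι hN ⟨hinj, himm⟩⟩
  rw [range_sliceMap]
  refine Subset.antisymm ?_ ?_
  · rintro _ ⟨x, rfl⟩
    exact ⟨hN x, hc x⟩
  · rintro z ⟨hz, hz5⟩
    obtain ⟨x, hx⟩ := exists_truncL_comp_eq_of_injective_mfderiv hι.contMDiff hN himm
      ⟨truncL z, truncL_mem_sphere hz⟩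
    exact ⟨x, eq_of_truncL_eq_of_apply_five_eq hx ((hc x).trans hz5.symm)⟩

end Summit.SmoothPoincare4.SmoothPoincare4.Cruxes.CylinderRungTwo.KillingFlux

end
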